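import Summits.AtomisticToContinuum.FouriersLaw.Theorems.OddSectorIrreversibilityResponseDensityGibbsTranspose
import Literature.MathematicalPhysics.KineticTheory.VelocityFlipNoise

/-!
# The Gibbs transpose of the flip generator `L + εS` (equilibrium `L²` structure of the flip chain)
(brick for crux stmt-AtomisticToContinuum-11976 `VanishingNoiseTransfer.VanishingNoiseBound`, line
`fekete-usc-one-length`, stub S3 `stub_noisyPositiveConductance`; worker file, wave 2)

Every Kubo/Onsager argument for the finite noisy chain (the residual content of S3: the finite-volume
Green–Kubo formula for `L + εS` and its sign) runs in `L²` of the equilibrium Gibbs measure at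
`T_L = T_R = T`, where "`A` is antisymmetric and `S`, `B_{j,T}` are symmetric" (Bernardin–Olla 2011, §2.1).
The tree has the generator-level generalised detailed balance of the flip-FREE chain
(`langevin_integral_gibbs_mul_generator`: `∫ π g₁ (L g₂) = ∫ π (L(g₁∘Θ))∘Θ · g₂`, `Θ(q,p) = (q,-p)`,
`π = e^{-H/T}`) and the symmetry of the flip noise `S` under any flip-invariant measure
(`integral_mul_flipNoise`). This file combines them into the same identity for the flip generator
`L_ε = L + εS` (`integral_gibbs_mul_flipGenerator`):

  `∫ π g₁ (L_ε g₂) dx = ∫ π · (L_ε(g₁∘Θ))∘Θ · g₂ dx`   (`g₁ ∈ C_c^∞`, `g₂ ∈ C^∞`),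

i.e. the `L²(μ_T)`-adjoint of `L + εS` on smooth functions is `Θ (L + εS) Θ` (the flips commute with
`Θ`: `(S(g∘Θ))∘Θ = S g`, `flipNoise_comp_momentumReversal`), together with the infinitesimal invariance
`∫ π (L + εS) f dx = 0` (`integral_gibbs_flipGenerator`). Stated for any oscillator chain with smooth
potentials, `γ ≥ 0`, `T > 0` and integrable Gibbs density; specialised to `pinnedChain`
(`pinnedChain_integral_gibbs_mul_flipGenerator`).

No definitions. Registered sub-goal: `helper_flipGibbsAdjoint`. References: Bernardin–Olla 2011, §2.1;
folklore.
-/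

noncomputable section

namespace Summit.AtomisticToContinuum.FouriersLaw.Theorems.VanishingNoiseBound

open MeasureTheory Filter Topology Set Function
open scoped ContDiff
open Literature.MathematicalPhysics.KineticTheory.HeatConduction
open Literature.MathematicalPhysics.KineticTheory

variable {N : ℕ}

/-- The single-site flips commute with the full momentum reversal `Θ(q,p) = (q,-p)`:
`(Θx)^i = Θ(x^i)`. [folklore] -/
theorem momentumFlip_momentumReversal (i : Fin N) (x : PhaseSpace N) :
    momentumFlip i (x.1, -x.2) = ((momentumFlip i x).1, -(momentumFlip i x).2) := by
  refine Prod.ext rfl (funext fun j => ?_)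
  by_cases h : j = i
  · subst h
    simp [momentumFlip]
  · simp [momentumFlip, h]

/-- **The flip noise commutes with momentum reversal**: `(S(g∘Θ))(Θx) = (S g)(x)`. [folklore] -/
theorem flipNoise_comp_momentumReversal (g : PhaseSpace N → ℝ) (x : PhaseSpace N) :
    flipNoise N (fun y => g (y.1, -y.2)) (x.1, -x.2) = flipNoise N g x := by
  simp only [flipNoise_eq]
  refine Finset.sum_congr rfl fun i _ => ?_
  rw [momentumFlip_momentumReversal]
  simp only [neg_neg, Prod.mk.eta]

/-- The single-site momentum flip as a homeomorphism of phase space (an involution). [folklore] -/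
theorem momentumFlip_isHomeomorph (i : Fin N) :
    ∃ φ : PhaseSpace N ≃ₜ PhaseSpace N, ⇑φ = momentumFlip i :=
  ⟨{ toFun := momentumFlip i, invFun := momentumFlip i, left_inv := momentumFlip_momentumFlip i,
      right_inv := momentumFlip_momentumFlip i, continuous_toFun := continuous_momentumFlip i,
      continuous_invFun := continuous_momentumFlip i }, rfl⟩

/-- `S h` has compact support if `h` has (its support lies in `K ∪ ⋃_i (·^i)(K)`). [folklore] -/
theorem hasCompactSupport_flipNoise {h : PhaseSpace N → ℝ} (hh : HasCompactSupport h) :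
    HasCompactSupport (flipNoise N h) := by
  have e : flipNoise N h = ∑ i : Fin N, ((h ∘ momentumFlip i) - h) := by
    funext x
    rw [flipNoise_eq, Finset.sum_apply]
    rfl
  rw [e]
  refine HasCompactSupport.finset_sum fun i _ => HasCompactSupport.sub ?_ hh
  obtain ⟨φ, hφ⟩ := momentumFlip_isHomeomorph i
  rw [← hφ]
  exact hh.comp_homeomorph φ

/-- `S h` is continuous if `h` is. [folklore] -/
theorem continuous_flipNoise {h : PhaseSpace N → ℝ} (hh : Continuous h) : Continuous (flipNoise N h) := by
  have e : flipNoise N h = fun x => ∑ i : Fin N, (h (momentumFlip i x) - h x) := funext (flipNoise_eq N h)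
  rw [e]
  exact continuous_finsetSum _ fun i _ => (hh.comp (continuous_momentumFlip i)).sub hh

section Adjoint

variable (P : OscillatorChain) (hU : ContDiff ℝ ∞ P.U) (hV : ContDiff ℝ ∞ P.V) (hN : 0 < N)
  (hγ : 0 ≤ P.γ) {T : ℝ} (hT : 0 < T) (hZ : Integrable (P.gibbsDensity N T))

include hZ in
/-- **`S` is symmetric against the Gibbs weight**: `∫ π g₁ (S g₂) dx = ∫ π (S g₁) g₂ dx` for continuous
`g₁` with compact support and continuous `g₂` (`π = e^{-H/T}` integrable): the Gibbs measure is
flip-invariant and `S` is symmetric in `L²` of every flip-invariant measure (`integral_mul_flipNoise`).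
[Bernardin–Olla 2011, §2.1] [folklore] -/
theorem integral_gibbs_mul_flipNoise {g₁ g₂ : PhaseSpace N → ℝ} (hg₁ : Continuous g₁)
    (hg₁c : HasCompactSupport g₁) (hg₂ : Continuous g₂) :
    ∫ x, P.gibbsDensity N T x * g₁ x * flipNoise N g₂ x =
      ∫ x, P.gibbsDensity N T x * flipNoise N g₁ x * g₂ x := by
  haveI : IsProbabilityMeasure (P.gibbsMeasure N T) := P.isProbabilityMeasure_gibbsMeasure hZ
  have hZpos : 0 < ∫ x, P.gibbsDensity N T x := integral_exp_pos hZ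
  -- both sides as Gibbs expectations
  have key : ∀ g : PhaseSpace N → ℝ, ∫ x, P.gibbsDensity N T x * g x =
      (∫ x, P.gibbsDensity N T x) * ∫ x, g x ∂(P.gibbsMeasure N T) := by
    intro g
    rw [P.integral_gibbsMeasure g, ← mul_assoc, mul_inv_cancel₀ hZpos.ne', one_mul]
    exact integral_congr_ae (Eventually.of_forall fun x => by simp only; ring)
  have e1 : (fun x => P.gibbsDensity N T x * g₁ x * flipNoise N g₂ x) =
      fun x => P.gibbsDensity N T x * (g₁ x * flipNoise N g₂ x) := funext fun x => by ring
  have e2 : (fun x => P.gibbsDensity N T x * flipNoise N g₁ x * g₂ x) =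
      fun x => P.gibbsDensity N T x * (flipNoise N g₁ x * g₂ x) := funext fun x => by ring
  rw [e1, e2, key, key]
  congr 1
  have hflip := fun i => P.measurePreserving_momentumFlip_gibbsMeasure N T i
  refine integral_mul_flipNoise hflip ?_ fun i => ?_
  · exact ((hg₁.mul hg₂).integrable_of_hasCompactSupport hg₁c.mul_right)
  · exact ((hg₁.mul (hg₂.comp (continuous_momentumFlip i))).integrable_of_hasCompactSupport
      hg₁c.mul_right)

include hU hV hN hγ hT hZ in
/-- **Generalised detailed balance for the flip generator, at the level of the generator**:
`∫ π g₁ (L_ε g₂) dx = ∫ π · (L_ε(g₁∘Θ))∘Θ · g₂ dx` for `g₁ ∈ C_c^∞`, `g₂ ∈ C^∞`, every rate `ε`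
(`L_ε = L + εS`, `Θ(q,p) = (q,-p)`, `π = e^{-H/T}`): the `L²(μ_T)`-adjoint of `L + εS` on smooth
functions is `Θ(L + εS)Θ` — "`A` is antisymmetric and `S`, `B_{j,T}` are symmetric". From the tree's
flip-free identity `langevin_integral_gibbs_mul_generator` and `integral_gibbs_mul_flipNoise`, the flips
commuting with `Θ`. [Bernardin–Olla 2011, §2.1] [folklore] -/
theorem integral_gibbs_mul_flipGenerator (ε : ℝ) {g₁ g₂ : PhaseSpace N → ℝ} (hg₁ : ContDiff ℝ ∞ g₁)
    (hg₁c : HasCompactSupport g₁) (hg₂ : ContDiff ℝ ∞ g₂) :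
    ∫ x, P.gibbsDensity N T x * g₁ x * P.flipGenerator N T T ε g₂ x =
      ∫ x, P.gibbsDensity N T x * P.flipGenerator N T T ε (fun y => g₁ (y.1, -y.2)) (x.1, -x.2) * g₂ x := by
  have hπ : Continuous (P.gibbsDensity N T) := by
    have h : P.gibbsDensity N T = fun y => Real.exp (-P.hamiltonian N y / T) := rfl
    rw [h]
    exact Real.continuous_exp.comp ((P.continuous_hamiltonian hU.continuous hV.continuous N).neg.div_const T)
  have hU1 : ContDiff ℝ 1 P.U := hU.of_le (by norm_cast)
  have hV1 : ContDiff ℝ 1 P.V := hV.of_le (by norm_cast)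
  have hg₂2 : ContDiff ℝ 2 g₂ := hg₂.of_le (by norm_cast)
  -- the reversed test function
  have hg₁Θ : ContDiff ℝ ∞ fun y : PhaseSpace N => g₁ (y.1, -y.2) :=
    hg₁.comp (contDiff_fst.prodMk contDiff_snd.neg)
  have hg₁Θc : HasCompactSupport fun y : PhaseSpace N => g₁ (y.1, -y.2) := by
    have e : (fun y : PhaseSpace N => g₁ (y.1, -y.2)) = g₁ ∘ (momentumReversal N) := by
      funext y; simp
    rw [e]
    exact hg₁c.comp_homeomorph ((Homeomorph.refl (Fin N → ℝ)).prodCongr (Homeomorph.neg (Fin N → ℝ)))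
  have hg₁Θ2 : ContDiff ℝ 2 fun y : PhaseSpace N => g₁ (y.1, -y.2) := hg₁Θ.of_le (by norm_cast)
  -- integrability of the four compactly supported continuous integrands
  have hLg₂ : Continuous (P.generator N T T g₂) := P.continuous_generator hU1 hV1 N T T hg₂2
  have hSg₂ : Continuous (flipNoise N g₂) := continuous_flipNoise hg₂.continuous
  have hLΘ : Continuous (P.generator N T T fun y : PhaseSpace N => g₁ (y.1, -y.2)) :=
    P.continuous_generator hU1 hV1 N T T hg₁Θ2
  have hLΘc : HasCompactSupport (P.generator N T T fun y : PhaseSpace N => g₁ (y.1, -y.2)) :=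
    P.hasCompactSupport_generator N T T hg₁Θ2 hg₁Θc
  have hSΘ : Continuous (flipNoise N fun y : PhaseSpace N => g₁ (y.1, -y.2)) :=
    continuous_flipNoise hg₁Θ.continuous
  have hSΘc : HasCompactSupport (flipNoise N fun y : PhaseSpace N => g₁ (y.1, -y.2)) :=
    hasCompactSupport_flipNoise hg₁Θc
  have hΘ : Continuous fun x : PhaseSpace N => ((x.1, -x.2) : PhaseSpace N) := by fun_prop
  have i1 : Integrable fun x => P.gibbsDensity N T x * g₁ x * P.generator N T T g₂ x :=
    ((hπ.mul hg₁.continuous).mul hLg₂).integrable_of_hasCompactSupport (hg₁c.mul_left.mul_right)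
  have i2 : Integrable fun x => P.gibbsDensity N T x * g₁ x * (ε * flipNoise N g₂ x) :=
    ((hπ.mul hg₁.continuous).mul (continuous_const.mul hSg₂)).integrable_of_hasCompactSupport
      (hg₁c.mul_left.mul_right)
  have i3 : Integrable fun x => P.gibbsDensity N T x *
      P.generator N T T (fun y : PhaseSpace N => g₁ (y.1, -y.2)) (x.1, -x.2) * g₂ x :=
    ((hπ.mul (hLΘ.comp hΘ)).mul hg₂.continuous).integrable_of_hasCompactSupport
      ((hLΘc.comp_homeomorph ((Homeomorph.refl (Fin N → ℝ)).prodCongr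
        (Homeomorph.neg (Fin N → ℝ)))).mul_left.mul_right)
  have i4 : Integrable fun x => P.gibbsDensity N T x *
      (ε * flipNoise N (fun y : PhaseSpace N => g₁ (y.1, -y.2)) (x.1, -x.2)) * g₂ x :=
    ((hπ.mul (continuous_const.mul (hSΘ.comp hΘ))).mul hg₂.continuous).integrable_of_hasCompactSupport
      (((hSΘc.comp_homeomorph ((Homeomorph.refl (Fin N → ℝ)).prodCongr
        (Homeomorph.neg (Fin N → ℝ)))).mul_left).mul_left.mul_right)
  -- split `L_ε = L + εS` on both sides
  have eL : ∀ x, P.gibbsDensity N T x * g₁ x * P.flipGenerator N T T ε g₂ x =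
      P.gibbsDensity N T x * g₁ x * P.generator N T T g₂ x +
        P.gibbsDensity N T x * g₁ x * (ε * flipNoise N g₂ x) := fun x => by
    rw [P.flipGenerator_eq_add_flipNoise]; ring
  have eR : ∀ x, P.gibbsDensity N T x *
      P.flipGenerator N T T ε (fun y : PhaseSpace N => g₁ (y.1, -y.2)) (x.1, -x.2) * g₂ x =
      P.gibbsDensity N T x * P.generator N T T (fun y : PhaseSpace N => g₁ (y.1, -y.2)) (x.1, -x.2) * g₂ x +
        P.gibbsDensity N T x * (ε * flipNoise N (fun y : PhaseSpace N => g₁ (y.1, -y.2)) (x.1, -x.2)) *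
          g₂ x := fun x => by
    rw [P.flipGenerator_eq_add_flipNoise]; ring
  simp_rw [eL, eR]
  rw [integral_add i1 i2, integral_add i3 i4,
    langevin_integral_gibbs_mul_generator P hU hV hN hγ hT hg₁ hg₁c hg₂]
  congr 1
  -- the flip part: `(S(g₁∘Θ))∘Θ = S g₁` and the symmetry of `S`
  simp_rw [flipNoise_comp_momentumReversal g₁]
  have e3 : (fun x => P.gibbsDensity N T x * g₁ x * (ε * flipNoise N g₂ x)) =
      fun x => ε * (P.gibbsDensity N T x * g₁ x * flipNoise N g₂ x) := funext fun x => by ring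
  have e4 : (fun x => P.gibbsDensity N T x * (ε * flipNoise N g₁ x) * g₂ x) =
      fun x => ε * (P.gibbsDensity N T x * flipNoise N g₁ x * g₂ x) := funext fun x => by ring
  rw [e3, e4, integral_const_mul, integral_const_mul,
    integral_gibbs_mul_flipNoise P hZ hg₁.continuous hg₁c hg₂.continuous]

include hU hV hN hγ hT hZ in
/-- **`∫ π (L + εS) f dx = 0` for `f ∈ C_c^∞`** (the Gibbs weight is infinitesimally invariant for the
flip generator, every rate). [Bernardin–Olla 2011, §2.1] [folklore] -/
theorem integral_gibbs_flipGenerator (ε : ℝ) {f : PhaseSpace N → ℝ} (hf : ContDiff ℝ ∞ f)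
    (hfc : HasCompactSupport f) :
    ∫ x, P.gibbsDensity N T x * P.flipGenerator N T T ε f x = 0 := by
  have hU1 : ContDiff ℝ 1 P.U := hU.of_le (by norm_cast)
  have hV1 : ContDiff ℝ 1 P.V := hV.of_le (by norm_cast)
  have hf2 : ContDiff ℝ 2 f := hf.of_le (by norm_cast)
  have hπ : Continuous (P.gibbsDensity N T) := by
    have h : P.gibbsDensity N T = fun y => Real.exp (-P.hamiltonian N y / T) := rfl
    rw [h]
    exact Real.continuous_exp.comp ((P.continuous_hamiltonian hU.continuous hV.continuous N).neg.div_const T)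
  have h0 := langevin_integral_gibbs_generator P hU hV hN hγ hT hf hfc
  have hS : ∫ x, P.gibbsDensity N T x * flipNoise N f x = 0 := by
    have h := integral_gibbs_mul_flipNoise P hZ hf.continuous hfc (continuous_const (y := (1:ℝ)))
    simp only [flipNoise_const, mul_zero, integral_zero, mul_one] at h
    exact h.symm
  have i1 : Integrable fun x => P.gibbsDensity N T x * P.generator N T T f x :=
    (hπ.mul (P.continuous_generator hU1 hV1 N T T hf2)).integrable_of_hasCompactSupport
      ((P.hasCompactSupport_generator N T T hf2 hfc).mul_left)
  have i2 : Integrable fun x => P.gibbsDensity N T x * (ε * flipNoise N f x) :=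
    (hπ.mul (continuous_const.mul (continuous_flipNoise hf.continuous))).integrable_of_hasCompactSupport
      ((hasCompactSupport_flipNoise hfc).mul_left.mul_left)
  have e : ∀ x, P.gibbsDensity N T x * P.flipGenerator N T T ε f x =
      P.gibbsDensity N T x * P.generator N T T f x + P.gibbsDensity N T x * (ε * flipNoise N f x) :=
    fun x => by rw [P.flipGenerator_eq_add_flipNoise]; ring
  simp_rw [e]
  rw [integral_add i1 i2, h0, zero_add]
  have e2 : (fun x => P.gibbsDensity N T x * (ε * flipNoise N f x)) =
      fun x => ε * (P.gibbsDensity N T x * flipNoise N f x) := funext fun x => by ring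
  rw [e2, integral_const_mul, hS, mul_zero]

end Adjoint

section Pinned

variable {ω₂ lam β γ : ℝ}

/-- **The Gibbs transpose of `L + εS` for the pinned anharmonic chain** (`ω₂ > 0`, `lam, β, γ ≥ 0`,
`N ≥ 1`, `T > 0`, every rate `ε`): `∫ π g₁ (L_ε g₂) dx = ∫ π (L_ε(g₁∘Θ))∘Θ g₂ dx` for `g₁ ∈ C_c^∞`,
`g₂ ∈ C^∞`. [Bernardin–Olla 2011, §2.1] [folklore] -/
theorem pinnedChain_integral_gibbs_mul_flipGenerator (hω : 0 < ω₂) (hl : 0 ≤ lam) (hβ : 0 ≤ β)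
    (hγ : 0 ≤ γ) (hN : 0 < N) {T : ℝ} (hT : 0 < T) (ε : ℝ) {g₁ g₂ : PhaseSpace N → ℝ}
    (hg₁ : ContDiff ℝ ∞ g₁) (hg₁c : HasCompactSupport g₁) (hg₂ : ContDiff ℝ ∞ g₂) :
    ∫ x, (pinnedChain ω₂ lam β γ).gibbsDensity N T x * g₁ x *
        (pinnedChain ω₂ lam β γ).flipGenerator N T T ε g₂ x =
      ∫ x, (pinnedChain ω₂ lam β γ).gibbsDensity N T x *
        (pinnedChain ω₂ lam β γ).flipGenerator N T T ε (fun y => g₁ (y.1, -y.2)) (x.1, -x.2) * g₂ x :=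
  integral_gibbs_mul_flipGenerator (pinnedChain ω₂ lam β γ) (pinnedChain_contDiff_U ω₂ lam β γ)
    (pinnedChain_contDiff_V ω₂ lam β γ) hN hγ hT (pinnedChain_integrable_gibbsDensity hω hl hβ γ N hT) ε
    hg₁ hg₁c hg₂

/-- **`∫ π (L + εS) f dx = 0`** for the pinned anharmonic chain at `T_L = T_R = T > 0`, `f ∈ C_c^∞`, every
rate. [Bernardin–Olla 2011, §2.1] [folklore] -/
theorem pinnedChain_integral_gibbs_flipGenerator (hω : 0 < ω₂) (hl : 0 ≤ lam) (hβ : 0 ≤ β) (hγ : 0 ≤ γ)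
    (hN : 0 < N) {T : ℝ} (hT : 0 < T) (ε : ℝ) {f : PhaseSpace N → ℝ} (hf : ContDiff ℝ ∞ f)
    (hfc : HasCompactSupport f) :
    ∫ x, (pinnedChain ω₂ lam β γ).gibbsDensity N T x * (pinnedChain ω₂ lam β γ).flipGenerator N T T ε f x = 0 :=
  integral_gibbs_flipGenerator (pinnedChain ω₂ lam β γ) (pinnedChain_contDiff_U ω₂ lam β γ)
    (pinnedChain_contDiff_V ω₂ lam β γ) hN hγ hT (pinnedChain_integrable_gibbsDensity hω hl hβ γ N hT) ε hf hfc

/-- **Registered sub-goal `helper_flipGibbsAdjoint`** of stmt-AtomisticToContinuum-11976 (brick for stub S3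
`stub_noisyPositiveConductance`): `pinnedChain_integral_gibbs_mul_flipGenerator`, fully quantified and
notation-free. [folklore] -/
theorem helper_flipGibbsAdjoint : ∀ (ω₂ lam β γ : ℝ), 0 < ω₂ → 0 ≤ lam → 0 ≤ β → 0 ≤ γ → ∀ (N : ℕ), 0 < N → ∀ (T : ℝ), 0 < T → ∀ (ε : ℝ) (g₁ g₂ : Literature.MathematicalPhysics.KineticTheory.HeatConduction.PhaseSpace N → ℝ), ContDiff ℝ ((⊤ : ℕ∞) : WithTop ℕ∞) g₁ → HasCompactSupport g₁ → ContDiff ℝ ((⊤ : ℕ∞) : WithTop ℕ∞) g₂ → MeasureTheory.integral MeasureTheory.volume (fun x : Literature.MathematicalPhysics.KineticTheory.HeatConduction.PhaseSpace N => (Literature.MathematicalPhysics.KineticTheory.HeatConduction.pinnedChain ω₂ lam β γ).gibbsDensity N T x * g₁ x * (Literature.MathematicalPhysics.KineticTheory.HeatConduction.pinnedChain ω₂ lam β γ).flipGenerator N T T ε g₂ x) = MeasureTheory.integral MeasureTheory.volume (fun x : Literature.MathematicalPhysics.KineticTheory.HeatConduction.PhaseSpace N => (Literature.MathematicalPhysics.KineticTheory.HeatConduction.pinnedChain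 ω₂ lam β γ).gibbsDensity N T x * (Literature.MathematicalPhysics.KineticTheory.HeatConduction.pinnedChain ω₂ lam β γ).flipGenerator N T T ε (fun y : Literature.MathematicalPhysics.KineticTheory.HeatConduction.PhaseSpace N => g₁ (y.1, -y.2)) (x.1, -x.2) * g₂ x) :=
  fun _ _ _ _ hω hl hβ hγ _ hN _ hT ε _ _ hg₁ hg₁c hg₂ =>
    pinnedChain_integral_gibbs_mul_flipGenerator hω hl hβ hγ hN hT ε hg₁ hg₁c hg₂

end Pinned

end Summit.AtomisticToContinuum.FouriersLaw.Theorems.VanishingNoiseBound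

end
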